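import Mathlib
import Summits.ValiantsHypothesis.ValiantsHypothesis.Theorems.TwoProducts.Negative.DatumExcessLaws
import HarnessLib

/-!
# `TwoProducts` (stmt-ValiantsHypothesis-5906), line `relation_ladder` — NEGATIVE lane: what ALL rank-one rungs cover, exactly
# (a datum exists iff the realised excess pairs are pairwise proportional; the datum is read off any one non-permutation coincidence)

Helper file of the Negative lane (val-neg-1 g4; `--supports stmt-ValiantsHypothesis-5906`; closes NO item).  `…Negative.DatumExcessLaws`
proved the necessary condition `rankOne_proportional`: under `RankOneCoincidences A ρ⁺ ρ⁻` any two non-permutation coincidences have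
proportional excess pairs (up to the swap).  This file proves the converse and packages the union of all rank-one rungs, whatever their
datum, into ONE datum-free condition on the family:

* `exists_primitive`: primitive part `(G, gX, gY)` of a pair of letter vectors `(X, Y) ≠ (0, 0)` — `X = G • gX`, `Y = G • gY`, `G ≠ 0`, and
  `(gX, gY)` is primitive in the operative sense `d ∣ c • (gX, gY) ⇒ d ∣ c`.
* `datum_from_base`: if every non-permutation coincidence is proportional (up to the swap) to a fixed one `(a₀, b₀)`, then the primitive
  part of the excess pair `(Q₀ ∸ P₀, P₀ ∸ Q₀)` of that base coincidence is a rank-one datum for the whole family.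
* `exists_datum_iff_proportional` (COVERAGE): `(∃ ρ⁺ ρ⁻, RankOneCoincidences A ρ⁺ ρ⁻) ↔` the realised excess pairs of `A` are pairwise
  proportional up to the swap; `exists_base_datum_of_rankOne`: if any datum serves `A`, then for EVERY non-permutation coincidence a datum
  dividing its excess pair serves `A` (the datum is read off one coincidence — the well-definedness a rung SCHEMA over `(ρ⁺, ρ⁻)` needs).

READING (information for the line owner, not an objection): the union of all rank-one rungs (R6 … R8 and every future fixed-datum or
schematic one) covers exactly the families whose realised coincidences have pairwise proportional excess pairs; its complement inside
the residual is «two realised coincidences with non-proportional excess pairs» (realised rank ≥ 2), cf. ✓ `…Negative.RankTwoEscapes`.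
Honest framing: helper lemmas only; `TwoProducts` (5906), `ResidualLawV20` and VP ≠ VNP are NOT proved here and are not claimed. [folklore]
-/

namespace Summit.ValiantsHypothesis.Theorems.TwoProducts.Negative.RankOneCoverage

open Finset
open Summit.ValiantsHypothesis.ValiantsHypothesis.Theorems.NewtonUnitEquations.TwoProducts.FormalLogLinearisation (Expo)
open Summit.ValiantsHypothesis.ValiantsHypothesis.Theorems.NewtonUnitEquations.TwoProducts.PlanarCell (tuples)
open Summit.ValiantsHypothesis.ValiantsHypothesis.Theorems.NewtonUnitEquations.TwoProducts.PermutationType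
  (msetT RankOneCoincidences)
open Summit.ValiantsHypothesis.Theorems.TwoProducts.Negative.DatumExcess

variable {m : ℕ}

/-! ### Primitive part of a pair of letter vectors -/

/-- **Primitive part.**  A pair `(X, Y) ≠ (0, 0)` of letter vectors is `G • (gX, gY)` with `G ≠ 0` and `(gX, gY)` primitive:
whenever `d ∣ c · gX e` and `d ∣ c · gY e` for all letters `e` (`d ≠ 0`), already `d ∣ c`. [folklore] -/
theorem exists_primitive (X Y : Expo →₀ ℕ) (hXY : ¬ (X = 0 ∧ Y = 0)) :
    ∃ G : ℕ, ∃ gX gY : Expo →₀ ℕ, G ≠ 0 ∧ X = G • gX ∧ Y = G • gY ∧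
      ∀ c d : ℕ, d ≠ 0 → (∀ e, d ∣ c * gX e) → (∀ e, d ∣ c * gY e) → d ∣ c := by
  classical
  set s : Finset (Expo ⊕ Expo) := X.support.disjSum Y.support with hs
  set f : Expo ⊕ Expo → ℕ := Sum.elim (⇑X) (⇑Y) with hf
  have memX : ∀ {e}, X e ≠ 0 → (Sum.inl e : Expo ⊕ Expo) ∈ s := fun he => by
    rw [hs, Finset.inl_mem_disjSum]; exact Finsupp.mem_support_iff.2 he
  have memY : ∀ {e}, Y e ≠ 0 → (Sum.inr e : Expo ⊕ Expo) ∈ s := fun he => by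
    rw [hs, Finset.inr_mem_disjSum]; exact Finsupp.mem_support_iff.2 he
  obtain ⟨i₀, hi₀s, hi₀⟩ : ∃ i ∈ s, f i ≠ 0 := by
    by_cases hX : X = 0
    · have hY : Y ≠ 0 := fun hY => hXY ⟨hX, hY⟩
      obtain ⟨e, he⟩ : ∃ e, Y e ≠ 0 := by
        by_contra! h
        exact hY (Finsupp.ext fun e => by simpa using h e)
      exact ⟨Sum.inr e, memY he, by simpa [hf] using he⟩
    · obtain ⟨e, he⟩ : ∃ e, X e ≠ 0 := by
        by_contra! h
        exact hX (Finsupp.ext fun e => by simpa using h e)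
      exact ⟨Sum.inl e, memX he, by simpa [hf] using he⟩
  have hG0 : s.gcd f ≠ 0 := by
    intro h0
    rw [Finset.gcd_eq_zero_iff] at h0
    exact hi₀ (h0 _ hi₀s)
  have hGX : ∀ e, s.gcd f ∣ X e := by
    intro e
    by_cases he : X e = 0
    · rw [he]; exact dvd_zero _
    · simpa [hf] using Finset.gcd_dvd (f := f) (memX he)
  have hGY : ∀ e, s.gcd f ∣ Y e := by
    intro e
    by_cases he : Y e = 0
    · rw [he]; exact dvd_zero _
    · simpa [hf] using Finset.gcd_dvd (f := f) (memY he)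
  refine ⟨s.gcd f, X.mapRange (· / s.gcd f) (Nat.zero_div _), Y.mapRange (· / s.gcd f) (Nat.zero_div _), hG0, ?_, ?_, ?_⟩
  · refine Finsupp.ext fun e => ?_
    simp only [Finsupp.smul_apply, Finsupp.mapRange_apply, smul_eq_mul]
    exact (Nat.mul_div_cancel' (hGX e)).symm
  · refine Finsupp.ext fun e => ?_
    simp only [Finsupp.smul_apply, Finsupp.mapRange_apply, smul_eq_mul]
    exact (Nat.mul_div_cancel' (hGY e)).symm
  · intro c d hd hcX hcY
    have h1 : s.gcd (fun j => f j / s.gcd f) = 1 := Finset.gcd_div_eq_one hi₀s hi₀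
    have h2 : d ∣ s.gcd (fun j => c * (f j / s.gcd f)) := by
      refine Finset.dvd_gcd fun j _ => ?_
      rcases j with e | e
      · have := hcX e
        simp only [Finsupp.mapRange_apply] at this
        simpa [hf] using this
      · have := hcY e
        simp only [Finsupp.mapRange_apply] at this
        simpa [hf] using this
    rw [Finset.gcd_mul_left, h1, mul_one, normalize_eq] at h2
    exact h2

/-- Integrality: a primitive pair divides every pair proportional to it. [folklore] -/
theorem nsmul_of_proportional {gX gY U V : Expo →₀ ℕ} {c D : ℕ} (hc : c ≠ 0)
    (hprim : ∀ c d : ℕ, d ≠ 0 → (∀ e, d ∣ c * gX e) → (∀ e, d ∣ c * gY e) → d ∣ c)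
    (hU : c • U = D • gX) (hV : c • V = D • gY) : ∃ k : ℕ, U = k • gX ∧ V = k • gY := by
  have eU : ∀ e, c * U e = D * gX e := fun e => by
    have := DFunLike.congr_fun hU e
    simpa only [Finsupp.smul_apply, smul_eq_mul] using this
  have eV : ∀ e, c * V e = D * gY e := fun e => by
    have := DFunLike.congr_fun hV e
    simpa only [Finsupp.smul_apply, smul_eq_mul] using this
  obtain ⟨k, hk⟩ : c ∣ D := hprim D c hc (fun e => ⟨U e, (eU e).symm⟩) (fun e => ⟨V e, (eV e).symm⟩)
  refine ⟨k, Finsupp.ext fun e => ?_, Finsupp.ext fun e => ?_⟩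
  · have h := eU e
    rw [hk, mul_assoc] at h
    simpa only [Finsupp.smul_apply, smul_eq_mul] using Nat.eq_of_mul_eq_mul_left (Nat.pos_of_ne_zero hc) h
  · have h := eV e
    rw [hk, mul_assoc] at h
    simpa only [Finsupp.smul_apply, smul_eq_mul] using Nat.eq_of_mul_eq_mul_left (Nat.pos_of_ne_zero hc) h

/-- Two letter multisets with both truncated differences zero are equal. [folklore] -/
theorem eq_of_tsub_eq_zero {P Q : Expo →₀ ℕ} (h₁ : P - Q = 0) (h₂ : Q - P = 0) : P = Q := by
  refine Finsupp.ext fun e => ?_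
  have e₁ := DFunLike.congr_fun h₁ e
  have e₂ := DFunLike.congr_fun h₂ e
  simp only [Finsupp.tsub_apply, Finsupp.coe_zero, Pi.zero_apply] at e₁ e₂
  omega

/-! ### The datum read off a base coincidence -/

/-- **Datum from a base coincidence.**  If every non-permutation coincidence of `A` is proportional (up to the swap) to a fixed
non-permutation coincidence `(a₀, b₀)`, then the primitive part `(ρ⁺, ρ⁻)` of `(Q₀ ∸ P₀, P₀ ∸ Q₀)` is a rank-one datum for `A`. [folklore] -/
theorem datum_from_base {A : Fin m → Finset Expo} {a₀ b₀ : Fin m → Expo} (hne₀ : msetT a₀ ≠ msetT b₀)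
    (hprop : ∀ a b : Fin m → Expo, a ∈ tuples A → b ∈ tuples A → ∑ j, a j = ∑ j, b j → msetT a ≠ msetT b →
      ∃ c d : ℕ, c ≠ 0 ∧ d ≠ 0 ∧
        ((c • (msetT a - msetT b) = d • (msetT a₀ - msetT b₀) ∧ c • (msetT b - msetT a) = d • (msetT b₀ - msetT a₀)) ∨
          (c • (msetT a - msetT b) = d • (msetT b₀ - msetT a₀) ∧ c • (msetT b - msetT a) = d • (msetT a₀ - msetT b₀)))) :
    ∃ G : ℕ, ∃ ρp ρm : Expo →₀ ℕ, G ≠ 0 ∧ msetT a₀ - msetT b₀ = G • ρm ∧ msetT b₀ - msetT a₀ = G • ρp ∧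
      RankOneCoincidences A ρp ρm := by
  classical
  have hXY : ¬ (msetT a₀ - msetT b₀ = 0 ∧ msetT b₀ - msetT a₀ = 0) := fun h => hne₀ (eq_of_tsub_eq_zero h.1 h.2)
  obtain ⟨G, gX, gY, hG0, hX, hY, hprim⟩ := exists_primitive (msetT a₀ - msetT b₀) (msetT b₀ - msetT a₀) hXY
  refine ⟨G, gY, gX, hG0, hX, hY, fun a ha b hb hab => ?_⟩
  by_cases hne : msetT a = msetT b
  · exact ⟨0, Or.inl (by simp [hne])⟩
  obtain ⟨c, d, hc, _hd, hcd⟩ := hprop a b ha hb hab hne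
  rcases hcd with ⟨h₁, h₂⟩ | ⟨h₁, h₂⟩
  · rw [hX, smul_smul] at h₁
    rw [hY, smul_smul] at h₂
    obtain ⟨k, hk₁, hk₂⟩ := nsmul_of_proportional hc hprim h₁ h₂
    exact ⟨k, Or.inl (shift_of_excess_eq hk₁.symm hk₂.symm)⟩
  · rw [hY, smul_smul] at h₁
    rw [hX, smul_smul] at h₂
    obtain ⟨k, hk₂, hk₁⟩ := nsmul_of_proportional hc (fun c d hd h1 h2 => hprim c d hd h2 h1) h₁ h₂
    exact ⟨k, Or.inr (shift_of_excess_eq hk₁.symm hk₂.symm)⟩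

/-! ### Coverage of the union of all rank-one rungs -/

/-- **Converse of `rankOne_proportional`.**  Pairwise proportional realised excess pairs (up to the swap) give a rank-one datum. [folklore] -/
theorem exists_datum_of_proportional {A : Fin m → Finset Expo}
    (hprop : ∀ a b a' b' : Fin m → Expo, a ∈ tuples A → b ∈ tuples A → ∑ j, a j = ∑ j, b j → msetT a ≠ msetT b →
      a' ∈ tuples A → b' ∈ tuples A → ∑ j, a' j = ∑ j, b' j → msetT a' ≠ msetT b' →
      ∃ c d : ℕ, c ≠ 0 ∧ d ≠ 0 ∧
        ((c • (msetT a - msetT b) = d • (msetT a' - msetT b') ∧ c • (msetT b - msetT a) = d • (msetT b' - msetT a')) ∨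
          (c • (msetT a - msetT b) = d • (msetT b' - msetT a') ∧ c • (msetT b - msetT a) = d • (msetT a' - msetT b')))) :
    ∃ ρp ρm : Expo →₀ ℕ, RankOneCoincidences A ρp ρm := by
  classical
  by_cases h0 : ∃ a₀ b₀ : Fin m → Expo, a₀ ∈ tuples A ∧ b₀ ∈ tuples A ∧ ∑ j, a₀ j = ∑ j, b₀ j ∧ msetT a₀ ≠ msetT b₀
  · obtain ⟨a₀, b₀, ha₀, hb₀, hab₀, hne₀⟩ := h0
    obtain ⟨_, ρp, ρm, -, -, -, h⟩ := datum_from_base hne₀ fun a b ha hb hab hne =>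
      hprop a b a₀ b₀ ha hb hab hne ha₀ hb₀ hab₀ hne₀
    exact ⟨ρp, ρm, h⟩
  · refine ⟨0, 0, fun a ha b hb hab => ⟨0, Or.inl ?_⟩⟩
    have : msetT a = msetT b := by
      by_contra hne
      exact h0 ⟨a, b, ha, hb, hab, hne⟩
    simp [this]

/-- **Coverage theorem.**  A family is served by SOME rank-one datum iff its realised excess pairs are pairwise proportional up to the
swap — the exact reach of the union of all rank-one rungs. [folklore] -/
theorem exists_datum_iff_proportional (A : Fin m → Finset Expo) :
    (∃ ρp ρm : Expo →₀ ℕ, RankOneCoincidences A ρp ρm) ↔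
      ∀ a b a' b' : Fin m → Expo, a ∈ tuples A → b ∈ tuples A → ∑ j, a j = ∑ j, b j → msetT a ≠ msetT b →
        a' ∈ tuples A → b' ∈ tuples A → ∑ j, a' j = ∑ j, b' j → msetT a' ≠ msetT b' →
        ∃ c d : ℕ, c ≠ 0 ∧ d ≠ 0 ∧
          ((c • (msetT a - msetT b) = d • (msetT a' - msetT b') ∧ c • (msetT b - msetT a) = d • (msetT b' - msetT a')) ∨
            (c • (msetT a - msetT b) = d • (msetT b' - msetT a') ∧ c • (msetT b - msetT a) = d • (msetT a' - msetT b'))) :=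
  ⟨fun ⟨_, _, h⟩ _ _ _ _ ha hb hab hne ha' hb' hab' hne' => rankOne_proportional h ha hb hab hne ha' hb' hab' hne',
    exists_datum_of_proportional⟩

/-- **The datum is read off any one non-permutation coincidence.**  If some datum serves `A`, then for every non-permutation coincidence
`(a₀, b₀)` a datum `(ρ⁺, ρ⁻)` with `G • ρ⁻ = P₀ ∸ Q₀`, `G • ρ⁺ = Q₀ ∸ P₀` (`G ≠ 0`) serves `A`. [folklore] -/
theorem exists_base_datum_of_rankOne {A : Fin m → Finset Expo} {ρp ρm : Expo →₀ ℕ} (h : RankOneCoincidences A ρp ρm)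
    {a₀ b₀ : Fin m → Expo} (ha₀ : a₀ ∈ tuples A) (hb₀ : b₀ ∈ tuples A) (hab₀ : ∑ j, a₀ j = ∑ j, b₀ j)
    (hne₀ : msetT a₀ ≠ msetT b₀) :
    ∃ G : ℕ, ∃ ρp' ρm' : Expo →₀ ℕ, G ≠ 0 ∧ msetT a₀ - msetT b₀ = G • ρm' ∧ msetT b₀ - msetT a₀ = G • ρp' ∧
      RankOneCoincidences A ρp' ρm' :=
  datum_from_base hne₀ fun _ _ ha hb hab hne => rankOne_proportional h ha hb hab hne ha₀ hb₀ hab₀ hne₀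

end Summit.ValiantsHypothesis.Theorems.TwoProducts.Negative.RankOneCoverage
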